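import Mathlib
import Literature.Computability.AlgebraicComplexity.FSS14TransferMatrixCode
import Literature.Computability.AlgebraicComplexity.FSV18SuccinctGenerators
import HarnessLib

/-!
# Forbes–Saptharishi–Shpilka 2014, §3.2–§3.3: the shift by an independent monomial map is a rank
# condenser (FSS14 Lemma 17, Cor. 26–27) — proofs, no statements

M. Forbes, R. Saptharishi, A. Shpilka, *Hitting sets for multilinear read-once algebraic branching
programs, in any order*, STOC 2014 = arXiv:1309.5668 [ForbesSaptharishiShpilka2014], §3.2 "Rank
condensers from good codes" (Lemma 17) and §3.3 (Cor. 26–27) (paper:arxiv-1309.5668 p0013–p0016).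
Second proof file of the discharge of FSV 2018 Lemma 40 (`FSV2018_lemma40` = [FSS14, Thm. 28]).

Main result: `isRankConcentrated_of_isIndepMonomialMap` = **[FSS14, Cor. 27]** in the currency
of FSV Defs. 38–39 (`IsIndepMonomialMap`, `IsRankConcentrated` of `FSV18SuccinctGenerators.lean`):
a family of at most `2^ℓ` polynomials of individual degree `≤ d` in the variables `S`, shifted by an
individual-degree-`d`, `|S|`-wise independent monomial map `g(t,s)`, is support-`ℓ` rank
concentrated over `𝔽(t,s)`.

Architecture (the printed one, [FSS14, Lemma 17 / Cor. 26 / Cor. 27]), with ONE deviation in the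
proof of Lemma 17: print expands an `s × s` minor of `H · W(t) · M` by Cauchy–Binet and isolates
the monomial of the (unique) minimum-weight row basis of `M`; here the same minor is shown to be
nonzero by the equivalent "echelon + leading monomial" argument — the column span of `M` has a
basis in echelon form w.r.t. the monomial order of the weights (`exists_echelon`), and for a
polynomial combination `λ` of these columns the top monomial of `H W M λ` is carried by the pivot
columns of `H` alone (`mulVec_weighted_ne_zero`), which are independent by the code property
(Lemma 24, file `FSS14TransferMatrixCode`). Cauchy–Binet is thereby avoided; the statement proved
is exactly Lemma 17's conclusion `rank_{𝔽(t)} (E(t) M) = rank M` in the form needed by Cor. 27.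
The passage from the fixed seed part `s = α` (Def. 38) back to generic `s` ("removing the
substitution of `s`", Cor. 26) is done on the minor: a specialisation of a nonzero determinant is
nonzero only if the determinant is.

No definitions of mathematical content, no named facts; nothing here bears on `VP ≠ VNP`.

## References
* [ForbesSaptharishiShpilka2014] arXiv:1309.5668, §3.2 Def. 13, Lemma 17; §3.3 Def. 25, Cor. 26,
  Cor. 27 (locator: paper:arxiv-1309.5668 p0013.txt:L7 – p0016.txt:L25).
* [ForbesShpilkaVolk2018] arXiv:1701.05328, Defs. 38–39, Lemma 40 (seq.) = ToC 5.14–5.16.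
-/

noncomputable section

open MvPolynomial Finset Matrix

open scoped BigOperators

namespace Literature.Computability.AlgebraicComplexity

namespace FSS2014

/-! ### Echelon bases (the row reduction behind "unique minimum-weight basis", Lemma 17) -/

section Echelon

variable {F X O : Type*} [Field F] [Fintype X] [LinearOrder O]

/-- **Echelon bases.** A subspace `V ⊆ F^X` of dimension `s`, the coordinates `X` being weighted
by `key : X → O` into a linear order, has a basis `u₁, …, u_s` with distinct pivots `p_i`, each
`u_i` supported on coordinates of weight `≤ key (p_i)`. This replaces the "standard greedy/matroid
arguments … there is a unique `T₀ ⊆ [m]` of size `s` such that `det(M|_{T₀}) ≠ 0` that minimizes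
`w(T₀)`" of [FSS14, Lemma 17, proof]: the pivot set is that `T₀`.
[cite: ForbesSaptharishiShpilka2014, Lemma 17 (proof)] locator: paper:arxiv-1309.5668 p0014.txt:L1 -/
theorem exists_echelon (key : X → O) (s : ℕ) (V : Submodule F (X → F))
    (hV : Module.finrank F V = s) :
    ∃ (u : Fin s → X → F) (p : Fin s → X), (∀ i, u i ∈ V) ∧ Function.Injective p ∧
      (∀ i, u i (p i) ≠ 0) ∧ (∀ i x, u i x ≠ 0 → key x ≤ key (p i)) := by
  classical
  induction s generalizing V with
  | zero => exact ⟨Fin.elim0, Fin.elim0, fun i => i.elim0, fun i => i.elim0, fun i => i.elim0,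
      fun i => i.elim0⟩
  | succ s ih =>
    -- a nonzero vector, hence a nonempty set of coordinates used by `V`
    have hpos : 0 < Module.finrank F V := by omega
    obtain ⟨v₁, hv₁V, hv₁⟩ : ∃ v ∈ V, v ≠ 0 := by
      by_contra h
      push Not at h
      have : V = ⊥ := by
        rw [Submodule.eq_bot_iff]; exact h
      rw [this, finrank_bot] at hpos
      exact lt_irrefl _ hpos
    obtain ⟨x₁, hx₁⟩ : ∃ x, v₁ x ≠ 0 := by
      by_contra h; push Not at h; exact hv₁ (funext h)
    set P : Finset X := univ.filter fun x => ∃ v ∈ V, v x ≠ 0 with hP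
    have hPne : P.Nonempty := ⟨x₁, by rw [hP, mem_filter]; exact ⟨mem_univ _, v₁, hv₁V, hx₁⟩⟩
    obtain ⟨pm, hpmP, hpmax⟩ := exists_max_image P key hPne
    obtain ⟨v₀, hv₀V, hv₀⟩ : ∃ v ∈ V, v pm ≠ 0 := by
      rw [hP, mem_filter] at hpmP
      exact hpmP.2
    -- the evaluation at the top pivot and its kernel
    set φ : V →ₗ[F] F := (LinearMap.proj pm).comp V.subtype with hφ
    have hφv₀ : φ ⟨v₀, hv₀V⟩ = v₀ pm := rfl
    have hrange : LinearMap.range φ = ⊤ := by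
      rw [eq_top_iff]
      intro c _
      refine ⟨(c / v₀ pm) • ⟨v₀, hv₀V⟩, ?_⟩
      rw [map_smul, hφv₀, smul_eq_mul, div_mul_cancel₀ _ hv₀]
    have hker : Module.finrank F (LinearMap.ker φ) = s := by
      have h1 := LinearMap.finrank_range_add_finrank_ker φ
      rw [hrange, finrank_top, Module.finrank_self, hV] at h1
      omega
    set V' : Submodule F (X → F) := (LinearMap.ker φ).map V.subtype with hV'
    have hV'fin : Module.finrank F V' = s := by
      rw [hV', ← hker]
      exact LinearEquiv.finrank_eq
        (Submodule.equivMapOfInjective _ V.injective_subtype _).symm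
    have hV'le : V' ≤ V := Submodule.map_subtype_le _ _
    have hV'pm : ∀ v ∈ V', v pm = 0 := by
      intro v hv
      rw [hV', Submodule.mem_map] at hv
      obtain ⟨w, hw, rfl⟩ := hv
      exact hw
    obtain ⟨u', p', hu'V, hp'inj, hpiv', hech'⟩ := ih V' hV'fin
    refine ⟨Fin.cons v₀ u', Fin.cons pm p', ?_, ?_, ?_, ?_⟩
    · intro i
      refine Fin.cases ?_ (fun i => ?_) i
      · simpa using hv₀V
      · simpa using hV'le (hu'V i)
    · rw [Fin.cons_injective_iff]
      refine ⟨?_, hp'inj⟩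
      rintro ⟨i, hi⟩
      have h1 := hpiv' i
      rw [hi, hV'pm _ (hu'V i)] at h1
      exact h1 rfl
    · intro i
      refine Fin.cases ?_ (fun i => ?_) i
      · simpa using hv₀
      · simpa using hpiv' i
    · intro i x
      refine Fin.cases ?_ (fun i => ?_) i
      · intro hx
        simp only [Fin.cons_zero] at hx ⊢
        exact hpmax x (by rw [hP, mem_filter]; exact ⟨mem_univ _, v₀, hv₀V, hx⟩)
      · intro hx
        simp only [Fin.cons_succ] at hx ⊢
        exact hech' i x hx

end Echelon

/-! ### Lemma 17, core: the top monomial of `H · W(t) · M λ` sits on the pivot columns -/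

section Valuation

variable {F : Type*} [Field F] {τ : Type*} (mo : MonomialOrder τ)
variable {X Y : Type*} [Fintype X] [DecidableEq X] {s : ℕ}

/-- **[FSS14, Lemma 17] (rank condenser from a good code), column form.** Data: weights
`W_x = c_x · t^{e(x)}` — nonzero, DISTINCT monomials (`e` injective); a matrix `H` over `𝔽` every
`s` columns of which are linearly independent ("the parity check matrix of an error correcting code
of distance `> s`"); and `s` vectors `u_i ∈ 𝔽^X` in echelon form for the order of the weights
(pivots `p_i`, `u_i` supported below `p_i`). Then the columns of `H · W · U` are linearly
independent over `𝔽[t]`: for `λ ∈ 𝔽[t]^s`, `λ ≠ 0`, the vector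
`(∑_i λ_i ∑_x u_i(x) W_x H_{y,x})_y` is nonzero. Proof: at the largest monomial
`deg λ_i + e(p_i)` only the pivot columns `H_{·,p_i}` contribute, with nonzero coefficients
("there is no cancellation of the nonzero term `c · w(T₀)`").
[cite: ForbesSaptharishiShpilka2014, Lemma 17] locator: paper:arxiv-1309.5668 p0013.txt:L28 – p0014.txt:L14 -/
theorem mulVec_weighted_ne_zero (e : X → τ →₀ ℕ) (he : Function.Injective e) (c : X → F)
    (hc : ∀ x, c x ≠ 0) (H : Y → X → F)
    (hcode : ∀ (I : Finset X), I.card ≤ s → ∀ κ : X → F,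
      (∀ y, ∑ x ∈ I, κ x * H y x = 0) → ∀ x ∈ I, κ x = 0)
    (u : Fin s → X → F) (p : Fin s → X) (hp : Function.Injective p) (hpiv : ∀ i, u i (p i) ≠ 0)
    (hech : ∀ i x, u i x ≠ 0 → mo.toSyn (e x) ≤ mo.toSyn (e (p i)))
    (lam : Fin s → MvPolynomial τ F) (hlam : lam ≠ 0) :
    (fun y => ∑ i, lam i * ∑ x, monomial (e x) (u i x * c x * H y x)) ≠ 0 := by
  classical
  -- the indices with `λ_i ≠ 0` and the top value of `deg λ_i + e(p_i)`
  set I₁ : Finset (Fin s) := univ.filter fun i => lam i ≠ 0 with hI₁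
  have hI₁ne : I₁.Nonempty := by
    by_contra h
    rw [not_nonempty_iff_eq_empty] at h
    apply hlam
    funext i
    by_contra hi
    have : i ∈ I₁ := by rw [hI₁, mem_filter]; exact ⟨mem_univ _, hi⟩
    rw [h] at this
    exact notMem_empty _ this
  set key : Fin s → mo.syn := fun i => mo.toSyn (mo.degree (lam i)) + mo.toSyn (e (p i)) with hkey
  set m₀s : mo.syn := I₁.sup' hI₁ne key with hm₀s
  set m₀ : τ →₀ ℕ := mo.toSyn.symm m₀s with hm₀
  have hm₀s' : mo.toSyn m₀ = m₀s := by rw [hm₀, AddEquiv.apply_symm_apply]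
  set I₀ : Finset (Fin s) := I₁.filter fun i => key i = m₀s with hI₀
  have hI₀ne : I₀.Nonempty := by
    obtain ⟨i, hi, hieq⟩ := exists_mem_eq_sup' hI₁ne key
    exact ⟨i, by rw [hI₀, mem_filter]; exact ⟨hi, hieq.symm⟩⟩
  have hkey_le : ∀ i ∈ I₁, key i ≤ m₀s := fun i hi => le_sup' key hi
  -- the coefficient of `t^{m₀}` in each term
  have hterm : ∀ (i : Fin s) (x : X) (r : F), (u i x = 0 → r = 0) →
      coeff m₀ (lam i * monomial (e x) r) =
        if i ∈ I₀ ∧ x = p i then mo.leadingCoeff (lam i) * r else 0 := by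
    intro i x r hr
    rw [coeff_mul_monomial']
    by_cases hux : u i x = 0
    · rw [hr hux, mul_zero, mul_zero, ite_self, ite_self]
    by_cases hli : lam i = 0
    · have : i ∉ I₀ := by
        rw [hI₀, mem_filter, hI₁, mem_filter]; exact fun h => h.1.2 hli
      simp [hli, this]
    have hiI₁ : i ∈ I₁ := by rw [hI₁, mem_filter]; exact ⟨mem_univ _, hli⟩
    split_ifs with h1 h2 h2
    · -- `e x ≤ m₀` and `i ∈ I₀, x = p i`: the coefficient is the leading one
      obtain ⟨hi0, rfl⟩ := h2
      have hk : key i = m₀s := by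
        have := hi0; rw [hI₀, mem_filter] at this; exact this.2
      have hm : m₀ = mo.degree (lam i) + e (p i) := by
        apply mo.toSyn.injective
        rw [hm₀s', ← hk, hkey, map_add]
      have : m₀ - e (p i) = mo.degree (lam i) := by
        rw [hm, add_tsub_cancel_right]
      rw [this, MonomialOrder.leadingCoeff]
    · -- `e x ≤ m₀` but not the pivot situation: the coefficient vanishes
      by_contra hne
      have hcoef : coeff (m₀ - e x) (lam i) ≠ 0 := fun h => hne (by rw [h, zero_mul])
      have hsupp : m₀ - e x ∈ (lam i).support := mem_support_iff.2 hcoef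
      have hdeg : mo.toSyn (m₀ - e x) ≤ mo.toSyn (mo.degree (lam i)) := mo.le_degree hsupp
      have hsum : m₀ - e x + e x = m₀ := tsub_add_cancel_of_le h1
      -- chain of inequalities, all equalities
      have hchain : mo.toSyn m₀ ≤ key i := by
        calc mo.toSyn m₀ = mo.toSyn (m₀ - e x) + mo.toSyn (e x) := by
              rw [← map_add, hsum]
          _ ≤ mo.toSyn (mo.degree (lam i)) + mo.toSyn (e (p i)) :=
              add_le_add hdeg (hech i x hux)
      have hki : key i = m₀s := le_antisymm (hkey_le i hiI₁) (hm₀s' ▸ hchain)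
      have hi0 : i ∈ I₀ := by rw [hI₀, mem_filter]; exact ⟨hiI₁, hki⟩
      -- equality in the chain forces `e x = e (p i)`
      have heq1 : mo.toSyn (m₀ - e x) + mo.toSyn (e x) =
          mo.toSyn (mo.degree (lam i)) + mo.toSyn (e (p i)) := by
        apply le_antisymm (add_le_add hdeg (hech i x hux))
        change key i ≤ _
        rw [hki, ← hm₀s', ← map_add, hsum]
      have hex : mo.toSyn (e x) = mo.toSyn (e (p i)) := by
        apply le_antisymm (hech i x hux)
        by_contra hlt
        push Not at hlt
        have := add_lt_add_of_le_of_lt hdeg hlt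
        rw [heq1] at this
        exact lt_irrefl _ this
      have hxp : x = p i := he (mo.toSyn.injective hex)
      exact h2 ⟨hi0, hxp⟩
    · -- the pivot situation forces `e x ≤ m₀`
      exfalso
      obtain ⟨hi0, rfl⟩ := h2
      have hk : key i = m₀s := by
        have := hi0; rw [hI₀, mem_filter] at this; exact this.2
      have hm : m₀ = mo.degree (lam i) + e (p i) := by
        apply mo.toSyn.injective
        rw [hm₀s', ← hk, hkey, map_add]
      exact h1 (hm ▸ le_add_self)
    · rfl
  -- test the `m₀`-coefficient: it is a nontrivial combination of `≤ s` pivot columns of `H`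
  intro hzero
  set θ : Fin s → F := fun i => mo.leadingCoeff (lam i) * (u i (p i) * c (p i)) with hθ
  have hcoeff : ∀ y, ∑ i ∈ I₀, θ i * H y (p i) = 0 := by
    intro y
    have hy := congrArg (fun v => coeff m₀ (v y)) hzero
    simp only [Pi.zero_apply, coeff_zero, coeff_sum] at hy
    rw [← hy]
    symm
    calc ∑ i, coeff m₀ (lam i * ∑ x, monomial (e x) (u i x * c x * H y x))
        = ∑ i, ∑ x, coeff m₀ (lam i * monomial (e x) (u i x * c x * H y x)) := by
          refine sum_congr rfl fun i _ => ?_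
          rw [mul_sum, coeff_sum]
      _ = ∑ i, ∑ x, (if i ∈ I₀ ∧ x = p i then
            mo.leadingCoeff (lam i) * (u i x * c x * H y x) else 0) := by
          refine sum_congr rfl fun i _ => sum_congr rfl fun x _ => ?_
          exact hterm i x _ (fun h => by rw [h, zero_mul, zero_mul])
      _ = ∑ i, (if i ∈ I₀ then mo.leadingCoeff (lam i) * (u i (p i) * c (p i) * H y (p i))
            else 0) := by
          refine sum_congr rfl fun i _ => ?_
          by_cases hi : i ∈ I₀
          · simp only [hi, true_and, if_true]
            rw [sum_ite_eq' univ (p i), if_pos (mem_univ _)]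
          · simp [hi]
      _ = ∑ i ∈ I₀, θ i * H y (p i) := by
          rw [← sum_filter]
          simp only [filter_mem_eq_inter, univ_inter]
          refine sum_congr rfl fun i _ => by rw [hθ]; ring
  -- transport to the image of the pivots and apply the code property
  set κ : X → F := fun x => ∑ i ∈ I₀.filter (fun i => p i = x), θ i with hκ
  have hκp : ∀ i ∈ I₀, κ (p i) = θ i := by
    intro i hi
    rw [hκ]
    have : I₀.filter (fun i' => p i' = p i) = {i} := by
      ext i'
      rw [mem_filter, mem_singleton]
      exact ⟨fun h => hp h.2, fun h => by subst h; exact ⟨hi, rfl⟩⟩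
    simp only [this, sum_singleton]
  have hIcard : (I₀.image p).card ≤ s := by
    calc (I₀.image p).card ≤ I₀.card := card_image_le
      _ ≤ (univ : Finset (Fin s)).card := card_le_card (subset_univ _)
      _ = s := by rw [card_univ, Fintype.card_fin]
  have hκrel : ∀ y, ∑ x ∈ I₀.image p, κ x * H y x = 0 := by
    intro y
    rw [sum_image (fun i _ i' _ h => hp h)]
    rw [← hcoeff y]
    exact sum_congr rfl fun i hi => by rw [hκp i hi]
  have hκ0 := hcode (I₀.image p) hIcard κ hκrel
  obtain ⟨i, hi⟩ := hI₀ne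
  have hθi : θ i = 0 := by
    rw [← hκp i hi]; exact hκ0 (p i) (mem_image_of_mem p hi)
  have hli : lam i ≠ 0 := by
    have := hi; rw [hI₀, mem_filter, hI₁, mem_filter] at this; exact this.1.2
  rw [hθ] at hθi
  simp only [mul_eq_zero, MonomialOrder.leadingCoeff_eq_zero_iff] at hθi
  rcases hθi with h | h | h
  · exact hli h
  · exact hpiv i h
  · exact hc _ h

end Valuation

/-! ### From independent columns to a nonzero maximal minor -/

section Minor

variable {L : Type*} [Field L] {Y : Type*} [Fintype Y] {s : ℕ}

/-- Over a field, a matrix with `s` linearly independent columns has a nonzero `s × s` minor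
(row rank = column rank). [folklore] -/
private theorem exists_submatrix_det_ne_zero (Q : Matrix Y (Fin s) L) (hQ : ∀ c : Fin s → L, Q *ᵥ c = 0 → c = 0) :
    ∃ r : Fin s → Y, (Q.submatrix r id).det ≠ 0 := by
  classical
  -- the rows span `L^s`
  have hspan : Submodule.span L (Set.range fun y => Q y) = ⊤ := by
    by_contra hne
    obtain ⟨f, hf0, hfle⟩ := Submodule.exists_le_ker_of_lt_top _ (lt_top_iff_ne_top.2 hne)
    apply hf0
    -- `f` is given by a vector `c` with `Q c = 0`
    set c : Fin s → L := fun i => f (Pi.single i 1) with hc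
    have hfc : ∀ w : Fin s → L, f w = ∑ i, w i * c i := by
      intro w
      conv_lhs => rw [show w = ∑ i, w i • (Pi.single i (1 : L) : Fin s → L) from
        (Finset.univ_sum_single w).symm ▸ by simp [Pi.single_apply, Finset.sum_fn]]
      rw [map_sum]
      exact sum_congr rfl fun i _ => by rw [map_smul, smul_eq_mul]
    have hQc : Q *ᵥ c = 0 := by
      funext y
      rw [Pi.zero_apply, mulVec, dotProduct, ← hfc]
      exact hfle (Submodule.subset_span ⟨y, rfl⟩)
    have hc0 := hQ c hQc
    refine LinearMap.ext fun w => ?_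
    rw [hfc, LinearMap.zero_apply]
    exact sum_eq_zero fun i _ => by rw [hc0, Pi.zero_apply, mul_zero]
  -- extract a basis among the rows
  obtain ⟨b, hbsub, hbspan, hbli⟩ := exists_linearIndependent L (Set.range fun y => Q y)
  rw [hspan] at hbspan
  have hbfin : b.Finite := (Set.finite_range _).subset hbsub
  haveI : Fintype b := hbfin.fintype
  have hcard : Fintype.card b = s := by
    have h1 := hbli.fintype_card_le_finrank
    have h2 : Module.finrank L (Fin s → L) = s := Module.finrank_fin_fun L
    rw [h2] at h1
    refine le_antisymm h1 ?_
    have h3 := finrank_span_le_card (R := L) b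
    rw [Set.toFinset_card, hbspan, finrank_top, h2] at h3
    exact h3
  -- choose preimages of the basis vectors among the rows
  have hpre : ∀ w : b, ∃ y : Y, Q y = w := fun w => by
    obtain ⟨y, hy⟩ := hbsub w.2; exact ⟨y, hy⟩
  choose ysel hysel using hpre
  set eqv : Fin s ≃ b := (Fintype.equivFinOfCardEq hcard).symm with heqv
  refine ⟨fun k => ysel (eqv k), ?_⟩
  have hli : LinearIndependent L (Q.submatrix (fun k => ysel (eqv k)) id).row := by
    have : (Q.submatrix (fun k => ysel (eqv k)) id).row = (fun w : b => (w : Fin s → L)) ∘ eqv := by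
      funext k
      ext j
      simp only [Matrix.row, Function.comp_apply, Matrix.submatrix_apply, id]
      exact congrFun (hysel (eqv k)) j
    rw [this]
    exact hbli.comp _ eqv.injective
  rw [Matrix.linearIndependent_rows_iff_isUnit, Matrix.isUnit_iff_isUnit_det] at hli
  exact hli.ne_zero

/-- Over a domain, a matrix whose columns are linearly independent (`Q c = 0 ⇒ c = 0`) has a
nonzero `s × s` minor — by passing to the fraction field ("rank over the field of rational
functions `𝔽(t)`", Def. 13). [folklore] -/
private theorem exists_submatrix_det_ne_zero_of_isDomain {A : Type*} [CommRing A] [IsDomain A]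
    (Q : Matrix Y (Fin s) A) (hQ : ∀ c : Fin s → A, Q *ᵥ c = 0 → c = 0) :
    ∃ r : Fin s → Y, (Q.submatrix r id).det ≠ 0 := by
  classical
  set L := FractionRing A
  set QL : Matrix Y (Fin s) L := Q.map (algebraMap A L) with hQL
  have hinj : Function.Injective (algebraMap A L) := IsFractionRing.injective A L
  have hQL' : ∀ c : Fin s → L, QL *ᵥ c = 0 → c = 0 := by
    intro c hc
    obtain ⟨⟨b, hb⟩, hbc⟩ := IsLocalization.exist_integer_multiples_of_finite (nonZeroDivisors A) c
    choose lam hlam using hbc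
    -- `Q λ = 0`
    have hQlam : Q *ᵥ lam = 0 := by
      have h1 : QL *ᵥ (fun i => algebraMap A L (lam i)) = 0 := by
        have : (fun i => algebraMap A L (lam i)) = fun i => (b : A) • c i := funext hlam
        rw [this, show (fun i => (b : A) • c i) = (b : A) • c from rfl, mulVec_smul, hc, smul_zero]
      funext y
      apply hinj
      have h2 := congrFun h1 y
      rw [Pi.zero_apply] at h2
      rw [Pi.zero_apply, map_zero, ← h2, hQL]
      simp only [mulVec, dotProduct, Matrix.map_apply, map_sum, map_mul]
    have hlam0 := hQ lam hQlam
    have hb0 : algebraMap A L b ≠ 0 :=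
      IsFractionRing.to_map_ne_zero_of_mem_nonZeroDivisors hb
    funext i
    have := hlam i
    rw [hlam0, Pi.zero_apply, map_zero, Algebra.smul_def] at this
    exact (mul_eq_zero.1 this.symm).resolve_left hb0
  obtain ⟨r, hr⟩ := exists_submatrix_det_ne_zero QL hQL'
  refine ⟨r, fun h0 => hr ?_⟩
  have : QL.submatrix r id = (Q.submatrix r id).map (algebraMap A L) := by
    rw [hQL]; rfl
  rw [this, ← RingHom.mapMatrix_apply, ← RingHom.map_det, h0, map_zero]

end Minor

/-! ### Cor. 26 / Cor. 27: rank concentration after the shift by an independent monomial map -/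

section Assembly

variable {R R' : Type*} [CommSemiring R] [CommSemiring R']

/-- Ring maps act on the transfer-matrix entries coordinatewise.
[cite: ForbesSaptharishiShpilka2014, Construction 19] locator: paper:arxiv-1309.5668 p0014.txt:L44–L46 -/
theorem map_shiftWt {ι : Type*} [Fintype ι] (ψ : R →+* R') (v : ι → R) (a b : ι →₀ ℕ) :
    ψ (shiftWt v a b) = shiftWt (fun i => ψ (v i)) a b := by
  rw [shiftWt, shiftWt, map_prod]
  refine prod_congr rfl fun i _ => ?_
  rw [map_mul, map_natCast, map_pow]

variable {F : Type*} [Field F] {ι τ τ' ρ : Type*} [Fintype ι] [DecidableEq ι] [Fintype ρ]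

/-- **[FSS14, Cor. 27] (with Lemma 17, Def. 25, Cor. 26), in the currency of FSV Defs. 38–39.**
"Let `f ∈ 𝔽[x]^r` be polynomials of individual degree `< d` on the `n` variables `x`. Let
`g : 𝔽^m × 𝔽^{m'} → 𝔽^n` be an individual degree `< d`, `n`-wise independent monomial map. Then
`f` has support-`⌈lg r⌉` rank concentration at `g(t,s)` over the field `𝔽(t,s)`." Tree form: at
most `2^ℓ` polynomials (`|ρ| ≤ 2^ℓ`) of individual degree `≤ d` in the variables `S`; `g` an
individual-degree-`d`, `ℓ'`-wise independent monomial map (`IsIndepMonomialMap`) with `|S| ≤ ℓ'`;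
conclusion `IsRankConcentrated ℓ` over any field `K` into which `𝔽[t,s]` embeds (e.g. `𝔽(t,s)`).
[cite: ForbesSaptharishiShpilka2014, Cor. 27] locator: paper:arxiv-1309.5668 p0016.txt:L16–L25 -/
theorem isRankConcentrated_of_isIndepMonomialMap (K : Type*) [Field K]
    [Algebra (MvPolynomial (τ ⊕ τ') F) K]
    (hinj : Function.Injective (algebraMap (MvPolynomial (τ ⊕ τ') F) K))
    (d ℓ ℓ' : ℕ) (S : Finset ι) (hS : S.card ≤ ℓ') (hρ : Fintype.card ρ ≤ 2 ^ ℓ)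
    (f : ρ → MvPolynomial ι F) (hf : ∀ j, ∀ b ∈ (f j).support, b.support ⊆ S ∧ ∀ i, b i ≤ d)
    (g : ι → MvPolynomial (τ ⊕ τ') F) (hg : IsIndepMonomialMap F d ℓ' g) :
    IsRankConcentrated (K := K) ℓ
      (fun j => MvPolynomial.map ((algebraMap (MvPolynomial (τ ⊕ τ') F) K).comp C) (f j))
      (fun i => algebraMap (MvPolynomial (τ ⊕ τ') F) K (g i)) := by
  classical
  -- ### Notation
  set φ := algebraMap (MvPolynomial (τ ⊕ τ') F) K with hφ
  set fK : ρ → MvPolynomial ι K := fun j => MvPolynomial.map (φ.comp C) (f j) with hfK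
  set vK : ι → K := fun i => φ (g i) with hvK
  set rowK : (ι →₀ ℕ) → ρ → K :=
    fun a j => coeff a (aeval (fun i => (X i + C (vK i) : MvPolynomial ι K)) (fK j)) with hrowK
  unfold IsRankConcentrated
  change Submodule.span K (Set.range fun a : {a : ι →₀ ℕ // a.support.card ≤ ℓ} => rowK a.1) =
    Submodule.span K (Set.range rowK)
  -- the finite set of exponents occurring in `f`, and the coefficient matrix `M`
  set Xs : Finset (ι →₀ ℕ) := univ.biUnion fun j => (f j).support with hXs
  have hXsS : ∀ x ∈ Xs, x.support ⊆ S ∧ ∀ i, x i ≤ d := by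
    intro x hx
    rw [hXs, mem_biUnion] at hx
    obtain ⟨j, -, hj⟩ := hx
    exact hf j x hj
  set M : Matrix Xs ρ F := fun x j => coeff x.1 (f j) with hM
  -- ### Step 1: the shift formula (Construction 19) for the rows
  have hrow : ∀ a j, rowK a j = ∑ x : Xs, φ (C (M x j)) * shiftWt vK a x.1 := by
    intro a j
    rw [hrowK]
    dsimp only
    rw [coeff_aeval_X_add_C vK (fK j) a]
    have h1 : ∀ b, coeff b (fK j) = φ (C (coeff b (f j))) := fun b => by
      rw [hfK]; exact coeff_map _ _ _
    have hsub : (fK j).support ⊆ Xs := by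
      intro b hb
      rw [hXs, mem_biUnion]
      refine ⟨j, mem_univ _, ?_⟩
      rw [mem_support_iff] at hb ⊢
      intro h0; apply hb; rw [h1, h0, C_0, map_zero]
    rw [sum_subset hsub (fun b _ hb => by rw [notMem_support_iff.1 hb, zero_mul])]
    rw [← sum_coe_sort Xs]
    exact sum_congr rfl fun x _ => by rw [h1]
  -- ### Step 2 (upper bound): all rows lie in the base change of the row space of `M`
  set s := M.rank with hs
  set W : Submodule F (ρ → F) := Submodule.span F (Set.range M.row) with hW
  have hWfin : Module.finrank F W = s := by rw [hs, rank_eq_finrank_span_row]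
  set bW := Module.finBasis F W
  set wK : Fin (Module.finrank F W) → ρ → K := fun k j => φ (C ((bW k : ρ → F) j)) with hwK
  have hMrow : ∀ x : Xs, (fun j => φ (C (M x j))) ∈ Submodule.span K (Set.range wK) := by
    intro x
    have hxW : M x ∈ W := Submodule.subset_span ⟨x, rfl⟩
    have hrepr := bW.sum_repr ⟨M x, hxW⟩
    have hrepr' : M x = ∑ k, (bW.repr ⟨M x, hxW⟩ k) • (bW k : ρ → F) := by
      have := congrArg Subtype.val hrepr
      rw [Submodule.coe_sum] at this
      simp_rw [Submodule.coe_smul] at this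
      exact this.symm
    have : (fun j => φ (C (M x j))) = ∑ k, φ (C (bW.repr ⟨M x, hxW⟩ k)) • wK k := by
      funext j
      have hj := congrFun hrepr' j
      rw [hj]
      simp only [Finset.sum_apply, Pi.smul_apply, smul_eq_mul, map_sum, map_mul, hwK]
    rw [this]
    exact Submodule.sum_mem _ fun k _ => Submodule.smul_mem _ _ (Submodule.subset_span ⟨k, rfl⟩)
  have hupper : Module.finrank K (Submodule.span K (Set.range rowK)) ≤ s := by
    have hle : Submodule.span K (Set.range rowK) ≤ Submodule.span K (Set.range wK) := by
      rw [Submodule.span_le]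
      rintro _ ⟨a, rfl⟩
      have : rowK a = ∑ x : Xs, shiftWt vK a x.1 • (fun j => φ (C (M x j))) := by
        funext j
        rw [hrow a j]
        simp only [Finset.sum_apply, Pi.smul_apply, smul_eq_mul]
        exact sum_congr rfl fun x _ => mul_comm _ _
      rw [this]
      exact Submodule.sum_mem _ fun x _ => Submodule.smul_mem _ _ (hMrow x)
    calc Module.finrank K (Submodule.span K (Set.range rowK))
        ≤ Module.finrank K (Submodule.span K (Set.range wK)) := Submodule.finrank_mono hle
      _ ≤ Fintype.card (Fin (Module.finrank F W)) := finrank_range_le_card wK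
      _ = s := by rw [Fintype.card_fin, hWfin]
  -- ### Step 3 (lower bound): `s` independent small-support rows
  -- 3a: the column space of `M`
  set U : Submodule F (Xs → F) := Submodule.span F (Set.range M.col) with hU
  have hUfin : Module.finrank F U = s := by rw [hs, rank_eq_finrank_span_cols]
  have hsle : s ≤ 2 ^ ℓ := (rank_le_card_width M).trans hρ
  -- 3b: the fixed seed part `α` and the exponents of the monomial map on the variables `S`
  obtain ⟨α, expo, hinjOn, hmon⟩ := hg S hS
  set gA : ι → MvPolynomial τ F := fun i => bind₁ (Sum.elim X fun j => C (α j)) (g i) with hgA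
  have hmonX : ∀ x : Xs, ∃ c : F, c ≠ 0 ∧
      ∏ i ∈ x.1.support, gA i ^ x.1 i = monomial (expo x.1) c := fun x =>
    hmon x.1 (hXsS x.1 x.2).1 (hXsS x.1 x.2).2
  choose cX hcX hwX using hmonX
  have heinj : Function.Injective fun x : Xs => expo x.1 := by
    intro x y hxy
    exact Subtype.ext (hinjOn ⟨(hXsS x.1 x.2).1, (hXsS x.1 x.2).2⟩ ⟨(hXsS y.1 y.2).1, (hXsS y.1 y.2).2⟩ hxy)
  -- 3c: a monomial order on the `t`-variables and an echelon basis of the column space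
  obtain ⟨lo, wf⟩ := exists_wellFoundedGT τ
  letI : LinearOrder τ := lo
  haveI : WellFoundedGT τ := wf
  set mo : MonomialOrder τ := MonomialOrder.lex with hmo
  obtain ⟨u, p, huU, hpinj, hpiv, hech⟩ :=
    exists_echelon (fun x : Xs => mo.toSyn (expo x.1)) s U hUfin
  -- 3d: coordinates of the basis vectors in terms of the columns of `M`
  have hP : ∀ i, ∃ P : ρ → F, ∀ x, u i x = ∑ j, P j * M x j := by
    intro i
    have := huU i
    rw [hU, Submodule.mem_span_range_iff_exists_fun] at this
    obtain ⟨P, hPi⟩ := this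
    refine ⟨P, fun x => ?_⟩
    have := congrFun hPi x
    simpa [Finset.sum_apply, Pi.smul_apply, smul_eq_mul, Matrix.col] using this.symm
  choose P hPu using hP
  -- 3e: the small-support rows and the code property (Lemma 24)
  set Ys : Finset (ι →₀ ℕ) := (boxExps S d).filter fun a => a.support.card ≤ ℓ with hYs
  have hYs_mem : ∀ y : Ys, y.1 ∈ boxExps S d ∧ y.1.support.card ≤ ℓ := fun y =>
    mem_filter.1 y.2
  have hcode : ∀ (I : Finset Xs), I.card ≤ s → ∀ κ : Xs → F,
      (∀ y : Ys, ∑ x ∈ I, κ x * (mchoose x.1 y.1 : F) = 0) → ∀ x ∈ I, κ x = 0 := by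
    intro I hI κ hrel x hx
    set μ : (ι →₀ ℕ) → F := fun b => if h : b ∈ Xs then κ ⟨b, h⟩ else 0 with hμ
    have hμx : μ x.1 = κ x := by rw [hμ]; simp [x.2]
    rw [← hμx]
    refine transferCode_eq_zero S d ℓ (I.map (Function.Embedding.subtype _))
      (fun b hb => ?_) ?_ μ (fun a ha hal => ?_) x.1 (mem_map.2 ⟨x, hx, rfl⟩)
    · rw [mem_map] at hb
      obtain ⟨x', -, rfl⟩ := hb
      exact hXsS x'.1 x'.2
    · rw [card_map]; exact hI.trans hsle
    · have hy : a ∈ Ys := by rw [hYs, mem_filter]; exact ⟨ha, hal⟩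
      have := hrel ⟨a, hy⟩
      rw [sum_map]
      rw [← this]
      refine sum_congr rfl fun x' _ => ?_
      simp only [Function.Embedding.coe_subtype, hμ, x'.2, dif_pos]
  -- 3f: Lemma 17 (column form) for the echelon basis
  have hval := mulVec_weighted_ne_zero mo (fun x : Xs => expo x.1) heinj cX hcX
    (fun (y : Ys) (x : Xs) => (mchoose x.1 y.1 : F)) hcode u p hpinj hpiv hech
  -- 3g: the matrix `Q = H · W · U` over `𝔽[t]` has independent columns, hence a nonzero minor
  set Q : Matrix Ys (Fin s) (MvPolynomial τ F) :=
    fun y i => ∑ x : Xs, monomial (expo x.1) (u i x * cX x * (mchoose x.1 y.1 : F)) with hQ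
  have hQcol : ∀ lam : Fin s → MvPolynomial τ F, Q *ᵥ lam = 0 → lam = 0 := by
    intro lam hlam
    by_contra hne
    apply hval lam hne
    funext y
    have := congrFun hlam y
    rw [Pi.zero_apply, mulVec, dotProduct] at this
    rw [Pi.zero_apply, ← this]
    exact sum_congr rfl fun i _ => mul_comm _ _
  obtain ⟨r, hr⟩ := exists_submatrix_det_ne_zero_of_isDomain Q hQcol
  -- 3h: `Q = Λ · T_A` with `T_A` the transfer matrix at `g(t, α)` times the basis (Cor. 26)
  set TA : Matrix Ys (Fin s) (MvPolynomial τ F) :=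
    fun y i => ∑ x : Xs, C (u i x) * shiftWt gA y.1 x.1 with hTA
  have hgApow : ∀ x : Xs, ∏ k, gA k ^ x.1 k = monomial (expo x.1) (cX x) := by
    intro x
    rw [← hwX x]
    exact (prod_subset (subset_univ _) fun k _ hk => by
      rw [Finsupp.notMem_support_iff.1 hk, pow_zero]).symm
  have hQTA : ∀ y i, Q y i = (∏ k, gA k ^ y.1 k) * TA y i := by
    intro y i
    rw [hQ, hTA]
    dsimp only
    rw [mul_sum]
    refine sum_congr rfl fun x _ => ?_
    rw [mul_left_comm, prod_pow_mul_shiftWt gA y.1 x.1, hgApow x, ← map_natCast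
      (C : F →+* MvPolynomial τ F), C_mul_monomial, C_mul_monomial]
    congr 1
    ring
  have hTAdet : (TA.submatrix r id).det ≠ 0 := by
    intro h0
    apply hr
    have : Q.submatrix r id =
        Matrix.of fun k i => (∏ k', gA k' ^ (r k).1 k') * (TA.submatrix r id) k i := by
      refine Matrix.ext fun k i => ?_
      simp only [submatrix_apply, id, of_apply]
      exact hQTA (r k) i
    rw [this, det_mul_column, h0, mul_zero]
  -- 3i: lift to `𝔽[t,s]`: `T_A` is the specialisation `s ↦ α` of `T_B`
  set ψ : MvPolynomial (τ ⊕ τ') F →ₐ[F] MvPolynomial τ F :=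
    aeval (Sum.elim X fun j => C (α j)) with hψ
  have hψg : ∀ i, ψ (g i) = gA i := fun i => rfl
  set TB : Matrix Ys (Fin s) (MvPolynomial (τ ⊕ τ') F) :=
    fun y i => ∑ x : Xs, C (u i x) * shiftWt g y.1 x.1 with hTB
  have hψTB : ∀ y i, ψ (TB y i) = TA y i := by
    intro y i
    rw [hTB, hTA]
    dsimp only
    rw [map_sum]
    refine sum_congr rfl fun x _ => ?_
    rw [map_mul, show ψ (C (u i x)) = C (u i x) from aeval_C _ _,
      show (ψ : MvPolynomial (τ ⊕ τ') F →ₐ[F] MvPolynomial τ F) (shiftWt g y.1 x.1) =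
        (ψ : MvPolynomial (τ ⊕ τ') F →+* MvPolynomial τ F) (shiftWt g y.1 x.1) from rfl,
      map_shiftWt]
    rfl
  have hTBdet : (TB.submatrix r id).det ≠ 0 := by
    intro h0
    apply hTAdet
    have : TA.submatrix r id = ((ψ : MvPolynomial (τ ⊕ τ') F →+* MvPolynomial τ F)).mapMatrix
        (TB.submatrix r id) := by
      refine Matrix.ext fun k i => ?_
      simp only [submatrix_apply, id, RingHom.mapMatrix_apply, Matrix.map_apply]
      exact (hψTB (r k) i).symm
    rw [this, ← RingHom.map_det, h0, map_zero]
  -- 3j: over `K`, the minor is the matrix of the `s` small rows `rowK (r k)` against `P`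
  set N : Matrix (Fin s) (Fin s) K := (TB.submatrix r id).map φ with hN
  have hNdet : N.det ≠ 0 := by
    rw [hN, ← RingHom.mapMatrix_apply, ← RingHom.map_det]
    exact fun h0 => hTBdet (hinj (by rw [h0, map_zero]))
  have hNrow : ∀ k i, N k i = ∑ j, φ (C (P i j)) * rowK (r k).1 j := by
    intro k i
    rw [hN]
    simp only [Matrix.map_apply, submatrix_apply, id, hTB]
    rw [map_sum]
    simp_rw [hrow]
    calc ∑ x : Xs, φ (C (u i x) * shiftWt g (r k).1 x.1)
        = ∑ x : Xs, (∑ j, φ (C (P i j)) * φ (C (M x j))) * shiftWt vK (r k).1 x.1 := by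
          refine sum_congr rfl fun x _ => ?_
          rw [map_mul, map_shiftWt, hPu i x, map_sum, map_sum]
          simp_rw [map_mul]
          rfl
      _ = ∑ j, φ (C (P i j)) * ∑ x : Xs, φ (C (M x j)) * shiftWt vK (r k).1 x.1 := by
          simp_rw [sum_mul, mul_sum, mul_assoc]
          rw [sum_comm]
  have hli : LinearIndependent K fun k : Fin s => rowK (r k).1 := by
    rw [Fintype.linearIndependent_iff]
    intro μ hμ
    have hvec : μ ᵥ* N = 0 := by
      funext i
      rw [vecMul, dotProduct, Pi.zero_apply]
      simp_rw [hNrow, mul_sum]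
      rw [sum_comm]
      have hμj : ∀ j, ∑ k, μ k * rowK (r k).1 j = 0 := fun j => by
        have := congrFun hμ j
        simpa [Finset.sum_apply, Pi.smul_apply, smul_eq_mul] using this
      refine sum_eq_zero fun j _ => ?_
      calc ∑ k, μ k * (φ (C (P i j)) * rowK (r k).1 j)
          = φ (C (P i j)) * ∑ k, μ k * rowK (r k).1 j := by
            rw [mul_sum]; exact sum_congr rfl fun k _ => by ring
        _ = 0 := by rw [hμj j, mul_zero]
    exact congrFun (Matrix.eq_zero_of_vecMul_eq_zero hNdet hvec)
  have hlower : s ≤ Module.finrank K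
      (Submodule.span K (Set.range fun a : {a : ι →₀ ℕ // a.support.card ≤ ℓ} => rowK a.1)) := by
    have h1 : Module.finrank K (Submodule.span K (Set.range fun k : Fin s => rowK (r k).1)) = s := by
      rw [finrank_span_eq_card hli, Fintype.card_fin]
    rw [← h1]
    refine Submodule.finrank_mono (Submodule.span_mono ?_)
    rintro _ ⟨k, rfl⟩
    exact ⟨⟨(r k).1, (hYs_mem (r k)).2⟩, rfl⟩
  -- ### Step 4: the two spans coincide
  refine Submodule.eq_of_le_of_finrank_le (Submodule.span_mono ?_) (hupper.trans hlower)
  rintro _ ⟨a, rfl⟩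
  exact ⟨a.1, rfl⟩

end Assembly


end FSS2014

end Literature.Computability.AlgebraicComplexity
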